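import Summits.Ventures.HodgeRepro2.T5BergmanFourier

/-!
# The reproducing kernel of the weighted Bergman space and the coherent states

The weighted Bergman space `A_k` (`k ≥ 2`) has the reproducing kernel

  `K_z(w) = (k-1)/π · (1 - z̄ w)^{-k}`,    `f(z) = ⟨f, K_z⟩_k` for every `f ∈ A_k`, `z ∈ 𝔻`

(`pairing_kernel`): with the binomial series `(1 - z̄ w)^{-k} = Σ_n C(n+k-1, n) (z̄ w)ⁿ` (Mathlib's
`hasSum_choose_mul_geometric_of_norm_lt_one`), the Fourier coefficients `⟨f, wⁿ⟩_k = a_n ⟨wⁿ, wⁿ⟩_k`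
(`T5BergmanFourier.pairing_monomial_right`), the identity `(k-1)/π · C(n+k-1, n) ⟨wⁿ, wⁿ⟩_k = 1`
(`T5BergmanMonomialNorm.ruhlInner_monomial_self`), the Cauchy–Schwarz inequality for the pairing
(`norm_pairing_sq_le`) and the density of the polynomials (`T5BergmanParseval.tendsto_pairing_sub_partialSum`).

The kernel is the orbit of the lowest-weight vector: for `g = su11 a b ∈ SU(1,1)`,
`(π_k(g) 1)(w) = (a - b̄ w)^{-k} = a^{-k} (1 - z̄ w)^{-k}` with `z = g · 0 = b/ā`
(`act_lowest_eq_kernel`) — the coherent states of the model are the (normalised) kernel functions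
`K_{g·0}`, and the matrix coefficient `⟨π_k(g) 1, 1⟩_k = a^{-k} π/(k-1)` (`pairing_act_lowest_eq`) is the
reproducing formula at `z = 0`.

Blind lane: Mathlib + the HodgeRepro2 prefix only; no sorry; axioms ⊆ {propext, Classical.choice,
Quot.sound}.
-/

namespace Summit.Ventures.HodgeRepro2.T5BergmanKernel

open MeasureTheory Metric Filter Topology T5BergmanCoefficient T5BergmanPairing T5BergmanUnitary
  T5BergmanMonomialNorm T5BergmanParseval T5BergmanFourier
open scoped Real

/-! ### Cauchy–Schwarz for the pairing -/

/-- **Cauchy–Schwarz**: `|⟨f, g⟩_k|² ≤ P(f) P(g)` for `f, g` in the space. -/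
theorem norm_pairing_sq_le (k : ℕ) {f g : ℂ → ℂ} (hf : ContinuousOn f (ball 0 1))
    (hg : ContinuousOn g (ball 0 1))
    (hfi : IntegrableOn (fun z => ‖f z‖ ^ 2 * (1 - ‖z‖ ^ 2) ^ (k - 2)) (ball (0 : ℂ) 1))
    (hgi : IntegrableOn (fun z => ‖g z‖ ^ 2 * (1 - ‖z‖ ^ 2) ^ (k - 2)) (ball (0 : ℂ) 1)) :
    ‖pairing k f g‖ ^ 2 ≤ (pairing k f f).re * (pairing k g g).re := by
  have hPf : pairing k f f = ((pairing k f f).re : ℂ) := pairing_self_eq_re k f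
  have hPg : pairing k g g = ((pairing k g g).re : ℂ) := pairing_self_eq_re k g
  have hA0 : 0 ≤ (pairing k f f).re := (pairing_self_nonneg k f).1
  have hB0 : 0 ≤ (pairing k g g).re := (pairing_self_nonneg k g).1
  set p := pairing k f g with hp
  set A := (pairing k f f).re with hA
  set B := (pairing k g g).re with hB
  clear_value p A B
  have hpp : p * (starRingEnd ℂ) p = ((‖p‖ : ℝ) : ℂ) ^ 2 := by
    rw [Complex.mul_conj, Complex.normSq_eq_norm_sq]
    push_cast
    rfl
  -- the quadratic inequality `0 ≤ A - 2 s |p|² + s² |p|² B` for every real `s`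
  have quad : ∀ s : ℝ, 0 ≤ A - 2 * s * ‖p‖ ^ 2 + s ^ 2 * ‖p‖ ^ 2 * B := by
    intro s
    have h1 := (pairing_self_nonneg k (f + fun z => (-(s : ℂ) * p) * g z)).1
    rw [pairing_self_add_const_mul k (-(s : ℂ) * p) hf hg hfi hgi, hPf, hPg, ← hp] at h1
    have hc : (A : ℂ) + ((starRingEnd ℂ) (-(s : ℂ) * p) * p + (-(s : ℂ) * p) * (starRingEnd ℂ) p) +
        (-(s : ℂ) * p) * (starRingEnd ℂ) (-(s : ℂ) * p) * (B : ℂ) =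
        ((A - 2 * s * ‖p‖ ^ 2 + s ^ 2 * ‖p‖ ^ 2 * B : ℝ) : ℂ) := by
      simp only [map_mul, map_neg, Complex.conj_ofReal]
      push_cast
      linear_combination (-(2 : ℂ) * s + (s : ℂ) ^ 2 * B) * hpp
    rw [hc, Complex.ofReal_re] at h1
    exact h1
  rcases hB0.lt_or_eq with hBpos | hBzero
  · -- `s = 1/B`
    have := quad (1 / B)
    have hB' : B ≠ 0 := hBpos.ne'
    have e : A - 2 * (1 / B) * ‖p‖ ^ 2 + (1 / B) ^ 2 * ‖p‖ ^ 2 * B = (A * B - ‖p‖ ^ 2) / B := by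
      field_simp
      ring
    rw [e, div_nonneg_iff] at this
    rcases this with ⟨h1, _⟩ | ⟨_, h2⟩
    · linarith
    · linarith
  · -- `B = 0`: then `p = 0`
    rw [← hBzero, mul_zero]
    by_contra hcon
    have hpos : 0 < ‖p‖ ^ 2 := lt_of_not_ge hcon
    have hp0 : ‖p‖ ≠ 0 := fun h => by rw [h] at hpos; simp at hpos
    have := quad ((A + 1) / ‖p‖ ^ 2)
    rw [← hBzero] at this
    have e : A - 2 * ((A + 1) / ‖p‖ ^ 2) * ‖p‖ ^ 2 + ((A + 1) / ‖p‖ ^ 2) ^ 2 * ‖p‖ ^ 2 * 0 = -A - 2 := by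
      field_simp
      ring
    rw [e] at this
    linarith

/-! ### The kernel function and its binomial series -/

/-- The (unnormalised) kernel function `K_z(w) = (1 - z̄ w)^{-k}`. -/
noncomputable def kernel (k : ℕ) (z : ℂ) : ℂ → ℂ := fun w => ((1 - (starRingEnd ℂ) z * w)⁻¹) ^ k

/-- The coefficients of the kernel's power series: `C(n+k-1, n) z̄ⁿ`. -/
noncomputable def kernelCoeff (k : ℕ) (z : ℂ) (n : ℕ) : ℂ :=
  (((n + k - 1).choose n : ℕ) : ℂ) * ((starRingEnd ℂ) z) ^ n

/-- `1 - z̄ w ≠ 0` for `|z| < 1`, `|w| ≤ 1`. -/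
lemma one_sub_conj_mul_ne_zero {z w : ℂ} (hz : z ∈ ball (0 : ℂ) 1) (hw : w ∈ closedBall (0 : ℂ) 1) :
    1 - (starRingEnd ℂ) z * w ≠ 0 := by
  intro h
  have h1 : (starRingEnd ℂ) z * w = 1 := by linear_combination -h
  have h2 : ‖(starRingEnd ℂ) z * w‖ = 1 := by rw [h1, norm_one]
  rw [norm_mul, Complex.norm_conj] at h2
  have hz' := mem_ball_zero_iff.mp hz
  have hw' := mem_closedBall_zero_iff.mp hw
  have : ‖z‖ * ‖w‖ ≤ ‖z‖ * 1 := mul_le_mul_of_nonneg_left hw' (norm_nonneg z)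
  linarith

/-- The kernel is continuous on the closed disc. -/
lemma continuousOn_kernel (k : ℕ) {z : ℂ} (hz : z ∈ ball (0 : ℂ) 1) :
    ContinuousOn (kernel k z) (closedBall (0 : ℂ) 1) := by
  unfold kernel
  apply ContinuousOn.pow
  apply ContinuousOn.inv₀
  · fun_prop
  · intro w hw
    exact one_sub_conj_mul_ne_zero hz hw

/-- A function continuous on the closed disc is in the space. -/
lemma integrableOn_sq_weight_of_continuousOn (k : ℕ) {g : ℂ → ℂ}
    (hg : ContinuousOn g (closedBall (0 : ℂ) 1)) :
    IntegrableOn (fun w => ‖g w‖ ^ 2 * (1 - ‖w‖ ^ 2) ^ (k - 2)) (ball (0 : ℂ) 1) :=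
  (((hg.norm.pow 2).mul (by fun_prop : Continuous fun w : ℂ => (1 - ‖w‖ ^ 2) ^ (k - 2)).continuousOn).integrableOn_compact
    (isCompact_closedBall 0 1)).mono_set ball_subset_closedBall

/-- **The binomial series of the kernel**: `(1 - z̄ w)^{-k} = Σ_n C(n+k-1, n) z̄ⁿ wⁿ` on `𝔻`. -/
theorem hasSum_kernel (k : ℕ) (hk : 2 ≤ k) {z : ℂ} (hz : z ∈ ball (0 : ℂ) 1) {w : ℂ}
    (hw : w ∈ ball (0 : ℂ) 1) :
    HasSum (fun n => kernelCoeff k z n * w ^ n) (kernel k z w) := by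
  obtain ⟨m, rfl⟩ := Nat.exists_eq_add_of_le' hk
  have hr : ‖(starRingEnd ℂ) z * w‖ < 1 := by
    rw [norm_mul, Complex.norm_conj]
    have hz' := mem_ball_zero_iff.mp hz
    have hw' := mem_ball_zero_iff.mp hw
    nlinarith [norm_nonneg z, norm_nonneg w]
  have h := hasSum_choose_mul_geometric_of_norm_lt_one (m + 1) hr
  rw [one_div, ← inv_pow] at h
  refine h.congr_fun fun n => ?_
  unfold kernelCoeff
  rw [show n + (m + 2) - 1 = n + (m + 1) by omega, Nat.choose_symm_add, mul_pow]
  ring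

/-- `C(n+k-1, n) ⟨zⁿ, zⁿ⟩_k = π/(k-1)`: the normalisation that makes the kernel reproduce. -/
lemma choose_mul_monomialNormSq (k : ℕ) (hk : 2 ≤ k) (n : ℕ) :
    (((n + k - 1).choose n : ℕ) : ℝ) * monomialNormSq k n = π / ((k : ℝ) - 1) := by
  obtain ⟨m, rfl⟩ := Nat.exists_eq_add_of_le' hk
  unfold monomialNormSq
  rw [show n + (m + 2) - 1 = (m + 1) + n by omega, show m + 2 - 2 = m by omega]
  have hc : ((((m + 1) + n).choose n : ℕ) : ℝ) * ((m + 1).factorial : ℝ) * (n.factorial : ℝ) =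
      (((m + 1) + n).factorial : ℝ) := by exact_mod_cast Nat.add_choose_mul_factorial_mul_factorial (m + 1) n
  rw [Nat.factorial_succ m] at hc
  have h1 : (((m + 1) + n).factorial : ℝ) ≠ 0 := by positivity
  have h2 : ((m : ℝ) + 2 - 1) ≠ 0 := by
    have : (0 : ℝ) ≤ m := by positivity
    linarith
  have h3 : (m.factorial : ℝ) ≠ 0 := by positivity
  have h4 : (n.factorial : ℝ) ≠ 0 := by positivity
  push_cast at hc ⊢
  field_simp
  linear_combination hc

/-! ### The reproducing formula -/

/-- `⟨f, S_N⟩_k = π/(k-1) · Σ_{n<N} a_n zⁿ` for the partial sums `S_N` of the kernel series. -/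
theorem pairing_kernel_partialSum (k : ℕ) (hk : 2 ≤ k) (a : ℕ → ℂ) (f : ℂ → ℂ)
    (hf : ∀ w ∈ ball (0 : ℂ) 1, HasSum (fun m => a m * w ^ m) (f w))
    (hint : IntegrableOn (fun w => ‖f w‖ ^ 2 * (1 - ‖w‖ ^ 2) ^ (k - 2)) (ball (0 : ℂ) 1))
    (z : ℂ) (N : ℕ) :
    pairing k f (partialSum (kernelCoeff k z) N) =
      ((π / ((k : ℝ) - 1) : ℝ) : ℂ) * ∑ n ∈ Finset.range N, a n * z ^ n := by
  have hfc : ContinuousOn f (ball 0 1) := continuousOn_ball a f hf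
  induction N with
  | zero =>
    simp only [Finset.range_zero, Finset.sum_empty, mul_zero]
    unfold pairing
    simp
  | succ N ih =>
    have e : partialSum (kernelCoeff k z) (N + 1) =
        partialSum (kernelCoeff k z) N + fun w => kernelCoeff k z N * w ^ N := by
      ext w
      simp [partialSum, Finset.sum_range_succ]
    have hS : IntegrableOn (fun w => ‖partialSum (kernelCoeff k z) N w‖ ^ 2 * (1 - ‖w‖ ^ 2) ^ (k - 2))
        (ball (0 : ℂ) 1) :=
      integrableOn_sq_weight_of_continuousOn k (by fun_prop : Continuous (partialSum (kernelCoeff k z) N)).continuousOn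
    have hM : IntegrableOn (fun w => ‖kernelCoeff k z N * w ^ N‖ ^ 2 * (1 - ‖w‖ ^ 2) ^ (k - 2))
        (ball (0 : ℂ) 1) :=
      integrableOn_sq_weight_of_continuousOn k (by fun_prop : Continuous fun w : ℂ => kernelCoeff k z N * w ^ N).continuousOn
    rw [e, pairing_add_right k
      (integrableOn_mul_conj k hfc (by fun_prop : Continuous (partialSum (kernelCoeff k z) N)).continuousOn hint hS)
      (integrableOn_mul_conj k hfc (by fun_prop : Continuous fun w : ℂ => kernelCoeff k z N * w ^ N).continuousOn hint hM),
      ih, pairing_const_mul_right, pairing_monomial_right k hk a f hf hint N, Finset.sum_range_succ,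
      mul_add]
    congr 1
    unfold kernelCoeff
    rw [map_mul, map_pow, Complex.conj_conj, map_natCast]
    have hc := choose_mul_monomialNormSq k hk N
    have hc' : (((N + k - 1).choose N : ℕ) : ℂ) * (monomialNormSq k N : ℂ) = ((π / ((k : ℝ) - 1) : ℝ) : ℂ) := by
      exact_mod_cast hc
    linear_combination (a N * z ^ N) * hc'

/-- **The reproducing formula**: `f(z) = (k-1)/π · ⟨f, K_z⟩_k`, i.e.
`⟨f, K_z⟩_k = π/(k-1) · f(z)` with `K_z(w) = (1 - z̄ w)^{-k}`, for every `f ∈ A_k` and `z ∈ 𝔻`. -/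
theorem pairing_kernel (k : ℕ) (hk : 2 ≤ k) (a : ℕ → ℂ) (f : ℂ → ℂ)
    (hf : ∀ w ∈ ball (0 : ℂ) 1, HasSum (fun m => a m * w ^ m) (f w))
    (hint : IntegrableOn (fun w => ‖f w‖ ^ 2 * (1 - ‖w‖ ^ 2) ^ (k - 2)) (ball (0 : ℂ) 1))
    {z : ℂ} (hz : z ∈ ball (0 : ℂ) 1) :
    pairing k f (kernel k z) = ((π / ((k : ℝ) - 1) : ℝ) : ℂ) * f z := by
  have hfc : ContinuousOn f (ball 0 1) := continuousOn_ball a f hf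
  have hK : ∀ w ∈ ball (0 : ℂ) 1, HasSum (fun n => kernelCoeff k z n * w ^ n) (kernel k z w) :=
    fun w hw => hasSum_kernel k hk hz hw
  have hKc : ContinuousOn (kernel k z) (ball 0 1) :=
    (continuousOn_kernel k hz).mono ball_subset_closedBall
  have hKi : IntegrableOn (fun w => ‖kernel k z w‖ ^ 2 * (1 - ‖w‖ ^ 2) ^ (k - 2)) (ball (0 : ℂ) 1) :=
    integrableOn_sq_weight_of_continuousOn k (continuousOn_kernel k hz)
  -- (2): `⟨f, S_N⟩ → ⟨f, K_z⟩` by Cauchy–Schwarz and the density of the polynomials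
  have hconv : Tendsto (fun N => pairing k f (partialSum (kernelCoeff k z) N)) atTop
      (𝓝 (pairing k f (kernel k z))) := by
    have hdens := tendsto_pairing_sub_partialSum k hk (kernelCoeff k z) (kernel k z) hK hKi
    rw [tendsto_iff_norm_sub_tendsto_zero]
    have hA0 : 0 ≤ (pairing k f f).re := (pairing_self_nonneg k f).1
    have hbound : ∀ N, ‖pairing k f (partialSum (kernelCoeff k z) N) - pairing k f (kernel k z)‖ ^ 2 ≤
        (pairing k f f).re *
          (pairing k (kernel k z - partialSum (kernelCoeff k z) N)
            (kernel k z - partialSum (kernelCoeff k z) N)).re := by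
      intro N
      have hSc : ContinuousOn (partialSum (kernelCoeff k z) N) (ball 0 1) :=
        (by fun_prop : Continuous (partialSum (kernelCoeff k z) N)).continuousOn
      have hS : IntegrableOn (fun w => ‖partialSum (kernelCoeff k z) N w‖ ^ 2 * (1 - ‖w‖ ^ 2) ^ (k - 2))
          (ball (0 : ℂ) 1) :=
        integrableOn_sq_weight_of_continuousOn k (by fun_prop : Continuous (partialSum (kernelCoeff k z) N)).continuousOn
      have hDc : ContinuousOn (kernel k z - partialSum (kernelCoeff k z) N) (ball 0 1) := hKc.sub hSc
      have hD : IntegrableOn (fun w => ‖(kernel k z - partialSum (kernelCoeff k z) N) w‖ ^ 2 *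
          (1 - ‖w‖ ^ 2) ^ (k - 2)) (ball (0 : ℂ) 1) :=
        integrableOn_sq_weight_of_continuousOn k ((continuousOn_kernel k hz).sub
          (by fun_prop : Continuous (partialSum (kernelCoeff k z) N)).continuousOn)
      have e : pairing k f (partialSum (kernelCoeff k z) N) - pairing k f (kernel k z) =
          -(pairing k f (kernel k z - partialSum (kernelCoeff k z) N)) := by
        have e2 : kernel k z - partialSum (kernelCoeff k z) N =
            kernel k z + fun w => (-1 : ℂ) * partialSum (kernelCoeff k z) N w := by
          ext w
          simp only [Pi.sub_apply, Pi.add_apply]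
          ring
        have hS' : IntegrableOn (fun w => ‖(-1 : ℂ) * partialSum (kernelCoeff k z) N w‖ ^ 2 *
            (1 - ‖w‖ ^ 2) ^ (k - 2)) (ball (0 : ℂ) 1) := by
          refine IntegrableOn.congr_fun hS (fun w _ => ?_) measurableSet_ball
          simp
        rw [e2, pairing_add_right k (g₁ := kernel k z)
          (g₂ := fun w => (-1 : ℂ) * partialSum (kernelCoeff k z) N w)
          (integrableOn_mul_conj k hfc hKc hint hKi)
          (integrableOn_mul_conj k hfc
            (by fun_prop : Continuous fun w : ℂ => (-1 : ℂ) * partialSum (kernelCoeff k z) N w).continuousOn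
            hint hS'), pairing_const_mul_right]
        simp only [map_neg, map_one]
        ring
      rw [e, norm_neg]
      exact norm_pairing_sq_le k hfc hDc hint hD
    have hlim : Tendsto (fun N => (pairing k f f).re *
        (pairing k (kernel k z - partialSum (kernelCoeff k z) N)
          (kernel k z - partialSum (kernelCoeff k z) N)).re) atTop (𝓝 0) := by
      simpa using hdens.const_mul (pairing k f f).re
    have hsq : Tendsto (fun N => ‖pairing k f (partialSum (kernelCoeff k z) N) -
        pairing k f (kernel k z)‖ ^ 2) atTop (𝓝 0) :=
      squeeze_zero (fun N => by positivity) hbound hlim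
    have := hsq.sqrt
    simpa [Real.sqrt_sq (norm_nonneg _)] using this
  -- (3): the partial sums `⟨f, S_N⟩ = π/(k-1) Σ_{n<N} a_n zⁿ` converge to `π/(k-1) f(z)`
  have hconv' : Tendsto (fun N => pairing k f (partialSum (kernelCoeff k z) N)) atTop
      (𝓝 (((π / ((k : ℝ) - 1) : ℝ) : ℂ) * f z)) := by
    simp_rw [pairing_kernel_partialSum k hk a f hf hint z]
    exact (hf z hz).tendsto_sum_nat.const_mul _
  exact tendsto_nhds_unique hconv hconv'

/-! ### The coherent states: the kernel is the orbit of the lowest-weight vector -/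

open T5SU11Unimodular T5SU11Fibration in
/-- **The coherent states**: `(π_k(g) 1)(w) = a^{-k} K_{g·0}(w)` for `g = su11 a b`, i.e. the orbit of the
lowest-weight vector consists of the kernel functions at `z = g · 0 = b/ā`, up to the scalar `a^{-k}`. -/
theorem act_lowest_eq_kernel (k : ℕ) (g : SU11) (w : ℂ) :
    act k g lowest w = (mat g 0 0)⁻¹ ^ k * kernel k (orbit g) w := by
  rw [act_lowest_apply, denom_inv_eq, orbit_eq]
  unfold kernel
  have hab := normSq_sub_normSq g
  have ha : mat g 0 0 ≠ 0 := by
    intro h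
    have h' : Complex.normSq (mat g 0 0) = 0 := by rw [h, map_zero]
    have : Complex.normSq (mat g 0 0) - Complex.normSq (mat g 0 1) = 1 := hab
    linarith [Complex.normSq_nonneg (mat g 0 1)]
  rw [map_div₀, Complex.conj_conj, ← mul_pow, ← mul_inv]
  congr 2
  field_simp

/-- The kernel reproduces itself: `⟨K_z, K_z⟩_k = π/(k-1) · K_z(z) = π/(k-1) · (1 - |z|²)^{-k}`. -/
theorem pairing_kernel_self (k : ℕ) (hk : 2 ≤ k) {z : ℂ} (hz : z ∈ ball (0 : ℂ) 1) :
    pairing k (kernel k z) (kernel k z) =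
      ((π / ((k : ℝ) - 1) : ℝ) : ℂ) * (((1 - ‖z‖ ^ 2)⁻¹ ^ k : ℝ) : ℂ) := by
  rw [pairing_kernel k hk (kernelCoeff k z) (kernel k z) (fun w hw => hasSum_kernel k hk hz hw)
    (integrableOn_sq_weight_of_continuousOn k (continuousOn_kernel k hz)) hz]
  congr 1
  unfold kernel
  rw [mul_comm, Complex.mul_conj, Complex.normSq_eq_norm_sq]
  push_cast
  ring

/-- **The sharp pointwise bound** from the reproducing formula:
`|f(z)|² ≤ (k-1)/π · (1 - |z|²)^{-k} · ⟨f, f⟩_k` for `f ∈ A_k`, `z ∈ 𝔻` (Cauchy–Schwarz against `K_z`). -/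
theorem norm_sq_le_pairing_sharp (k : ℕ) (hk : 2 ≤ k) (a : ℕ → ℂ) (f : ℂ → ℂ)
    (hf : ∀ w ∈ ball (0 : ℂ) 1, HasSum (fun m => a m * w ^ m) (f w))
    (hint : IntegrableOn (fun w => ‖f w‖ ^ 2 * (1 - ‖w‖ ^ 2) ^ (k - 2)) (ball (0 : ℂ) 1))
    {z : ℂ} (hz : z ∈ ball (0 : ℂ) 1) :
    ‖f z‖ ^ 2 ≤ (((k : ℝ) - 1) / π) * (1 - ‖z‖ ^ 2)⁻¹ ^ k * (pairing k f f).re := by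
  have hk1 : (0 : ℝ) < (k : ℝ) - 1 := by
    have : (2 : ℝ) ≤ k := by exact_mod_cast hk
    linarith
  have hKc : ContinuousOn (kernel k z) (ball 0 1) :=
    (continuousOn_kernel k hz).mono ball_subset_closedBall
  have hKi := integrableOn_sq_weight_of_continuousOn k (continuousOn_kernel k hz)
  have hCS := norm_pairing_sq_le k (continuousOn_ball a f hf) hKc hint hKi
  rw [pairing_kernel k hk a f hf hint hz, pairing_kernel_self k hk hz, norm_mul, Complex.norm_real,
    Real.norm_eq_abs, abs_of_pos (by positivity), mul_pow] at hCS
  have hKre : ((((π / ((k : ℝ) - 1) : ℝ) : ℂ) * (((1 - ‖z‖ ^ 2)⁻¹ ^ k : ℝ) : ℂ))).re =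
      π / ((k : ℝ) - 1) * (1 - ‖z‖ ^ 2)⁻¹ ^ k := by
    rw [← Complex.ofReal_mul, Complex.ofReal_re]
  rw [hKre] at hCS
  have hz' := mem_ball_zero_iff.mp hz
  have hw0 : 0 < 1 - ‖z‖ ^ 2 := by nlinarith [norm_nonneg z]
  have hc : 0 < (π / ((k : ℝ) - 1)) ^ 2 := by positivity
  -- `c² |f(z)|² ≤ A · c · w⁻¹ᵏ` with `c = π/(k-1)` ⇒ `|f(z)|² ≤ (A/c) w⁻¹ᵏ`
  have : ‖f z‖ ^ 2 ≤ (pairing k f f).re * (π / ((k : ℝ) - 1) * (1 - ‖z‖ ^ 2)⁻¹ ^ k) /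
      (π / ((k : ℝ) - 1)) ^ 2 := by
    rw [le_div_iff₀ hc]
    linarith
  calc ‖f z‖ ^ 2 ≤ (pairing k f f).re * (π / ((k : ℝ) - 1) * (1 - ‖z‖ ^ 2)⁻¹ ^ k) /
        (π / ((k : ℝ) - 1)) ^ 2 := this
    _ = (((k : ℝ) - 1) / π) * (1 - ‖z‖ ^ 2)⁻¹ ^ k * (pairing k f f).re := by
        field_simp

end Summit.Ventures.HodgeRepro2.T5BergmanKernel
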